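import Summits.QuantumFields.YangMills.Theorems.ColdStartUniversalityColdStartSolutionsExistAmbientCoordinates
import Literature.Probability.Process.ItoIntegralNegation
import HarnessLib

/-!
# Route `ColdStartUniversality`, support item S (stmt-QuantumFields-24811), line `piwiener`:
# stub A — ambient strong existence for tame link SDEs (`V`-valued), from the vector Picard theorem

Helper file (lead `ym-line-csu-p1`).  `ambient_exists_of_tame`: the statement of the registered stub
`stub_ambientStrongExistence` of `Cruxes/ColdStartSolutionsExist/Lines/piwiener.lean` (v5) with the workfile
definitions `IsTame` / `IsAmbientSolution` unfolded, for a GENERAL probability space with a flat Brownian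
motion: run `exists_vecSDE_solution` (`…VecPicard`) in quaternion coordinates (`…AmbientQuaternion`,
`…AmbientCoordinates`) and map back.  Revuz–Yor IX (2.1) for systems + the quaternion chart of
`V = span_ℝ SU(2)`.

No definition, no sorry.  RECORD-rung plumbing; nothing here bears on the Yang–Mills mass gap. -/

set_option autoImplicit false

noncomputable section

namespace Summit.QuantumFields.YangMills.Theorems.ColdStartUniversality

open MeasureTheory ProbabilityTheory Filter Topology Finset Matrix Complex
open scoped NNReal ENNReal BigOperators ComplexConjugate
open Literature.Probability.Process Literature.Analysis.FunctionSpaces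
open Literature.MathematicalPhysics.QuantumFieldTheory
open Literature.MathematicalPhysics.QuantumLattice (fundamentalRep)

variable {Ω : Type*} {mΩ : MeasurableSpace Ω} {P : Measure Ω} {L : ℕ} [NeZero L]
  {W : ℝ≥0 → Ω → (Edge 3 L × NoiseIdx 2 → ℝ)}

/-- **Ambient strong existence for tame link SDEs, `V`-valued (stub A, unfolded).**  For a link SDE `S`
on `M₂(ℂ)^E` with squared-Frobenius Lipschitz drift and noise coefficients mapping `V^E` to `V`
(`V = span_ℝ SU(2)`), on any probability space carrying a flat Brownian motion `W` (joint raw natural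
filtration `𝓕`) and for every `Q₀ ∈ V^E` there is a process `X` which is `𝓕`-adapted, entrywise
progressive, a.s. continuous, `L²(sup)` on bounded intervals, starts at `Q₀`, satisfies the entrywise Itô
equations `X_e(t)_{ij} = Q₀,e,ij + ∫₀ᵗ b_e(X_s)_{ij} ds + Σₙ J^{e,n}_{ij}(t)` with
`J^{e,n}_{ij} = ∫ σ_{e,n}(X)_{ij} dW^{e,n}` (tree `IsItoIntegralC`), and takes values in `V^E` surely.
Revuz–Yor (1999), Ch. IX, Thm (2.1), in quaternion coordinates. [cite: RevuzYor1999, Ch. IX Thm (2.1)] -/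
theorem ambient_exists_of_tame [IsProbabilityMeasure P] (hW : IsFlatBrownian W P)
    (S : LinkSDE 3 L 2 (NoiseIdx 2)) {K : ℝ}
    (hSd : ∀ (Q Q' : MatrixConfig 3 L 2) (e : Edge 3 L),
      hsForm 2 (S.drift Q e - S.drift Q' e) (S.drift Q e - S.drift Q' e) ≤
        K * ∑ e', hsForm 2 (Q e' - Q' e') (Q e' - Q' e'))
    (hSn : ∀ (Q Q' : MatrixConfig 3 L 2) (e : Edge 3 L) (n : NoiseIdx 2),
      hsForm 2 (S.noise Q e n - S.noise Q' e n) (S.noise Q e n - S.noise Q' e n) ≤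
        K * ∑ e', hsForm 2 (Q e' - Q' e') (Q e' - Q' e'))
    (hSV : ∀ Q : MatrixConfig 3 L 2, (∀ e, Q e ∈ Submodule.span ℝ (Set.range ⇑(fundamentalRep (Fin 2)))) →
      ∀ e, S.drift Q e ∈ Submodule.span ℝ (Set.range ⇑(fundamentalRep (Fin 2))) ∧
        ∀ n, S.noise Q e n ∈ Submodule.span ℝ (Set.range ⇑(fundamentalRep (Fin 2))))
    (Q₀ : MatrixConfig 3 L 2) (hQ₀ : ∀ e, Q₀ e ∈ Submodule.span ℝ (Set.range ⇑(fundamentalRep (Fin 2)))) :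
    ∃ X : ℝ≥0 → Ω → MatrixConfig 3 L 2,
      ((∀ t, Measurable[hW.natFiltration t] fun ω => (fun e i j => X t ω e i j : Edge 3 L → Fin 2 → Fin 2 → ℂ)) ∧
        (∀ e i j, IsStronglyProgressive hW.natFiltration (fun t ω => (X t ω e i j).re) ∧
          IsStronglyProgressive hW.natFiltration (fun t ω => (X t ω e i j).im)) ∧
        (∀ᵐ ω ∂P, Continuous fun t => X t ω) ∧
        (∀ t : ℝ≥0, ∫⁻ ω, ⨆ s ∈ Set.Iic t, ENNReal.ofReal (∑ e, hsForm 2 (X s ω e) (X s ω e)) ∂P < ∞) ∧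
        (∀ ω, X 0 ω = Q₀) ∧
        ∃ J : Edge 3 L → NoiseIdx 2 → Fin 2 → Fin 2 → ℝ≥0 → Ω → ℂ,
          (∀ e n i j, IsItoIntegralC (fun t ω => S.noise (X t ω) e n i j) (fun t ω => W t ω (e, n))
            (J e n i j) hW.natFiltration P) ∧
          ∀ᵐ ω ∂P, ∀ (t : ℝ≥0) (e : Edge 3 L) (i j : Fin 2),
            X t ω e i j = Q₀ e i j + (∫ s in (0 : ℝ)..t, S.drift (X s.toNNReal ω) e i j) + ∑ n, J e n i j t ω) ∧
      ∀ t ω e, X t ω e ∈ Submodule.span ℝ (Set.range ⇑(fundamentalRep (Fin 2))) := by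
  classical
  -- the filtration of the enumerated Brownian vector is the same
  have hfil := natFiltration_flat_eq hW
  -- nonnegative Lipschitz constant
  set Kp : ℝ := max K 0 with hKp
  have hKp0 : 0 ≤ Kp := le_max_right _ _
  have hsum0 : ∀ Q Q' : MatrixConfig 3 L 2, 0 ≤ ∑ e', hsForm 2 (Q e' - Q' e') (Q e' - Q' e') := fun Q Q' =>
    Finset.sum_nonneg fun _ _ => hsForm_self_nonneg _
  have hSd' : ∀ (Q Q' : MatrixConfig 3 L 2) (e : Edge 3 L),
      hsForm 2 (S.drift Q e - S.drift Q' e) (S.drift Q e - S.drift Q' e) ≤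
        Kp * ∑ e', hsForm 2 (Q e' - Q' e') (Q e' - Q' e') := fun Q Q' e =>
    (hSd Q Q' e).trans (mul_le_mul_of_nonneg_right (le_max_left _ _) (hsum0 Q Q'))
  have hSn' : ∀ (Q Q' : MatrixConfig 3 L 2) (e : Edge 3 L) (n : NoiseIdx 2),
      hsForm 2 (S.noise Q e n - S.noise Q' e n) (S.noise Q e n - S.noise Q' e n) ≤
        Kp * ∑ e', hsForm 2 (Q e' - Q' e') (Q e' - Q' e') := fun Q Q' e n =>
    (hSn Q Q' e n).trans (mul_le_mul_of_nonneg_right (le_max_left _ _) (hsum0 Q Q'))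
  -- the quaternion chart and the coefficients in coordinates
  set Φ : (Edge 3 L × Fin 4 → ℝ) → MatrixConfig 3 L 2 := fun y e =>
    !![((y (e, 0) : ℝ) : ℂ) + ((y (e, 1) : ℝ) : ℂ) * Complex.I, ((y (e, 2) : ℝ) : ℂ) + ((y (e, 3) : ℝ) : ℂ) * Complex.I;
      -((y (e, 2) : ℝ) : ℂ) + ((y (e, 3) : ℝ) : ℂ) * Complex.I, ((y (e, 0) : ℝ) : ℂ) - ((y (e, 1) : ℝ) : ℂ) * Complex.I]
    with hΦ
  have hΦV : ∀ y e, Φ y e ∈ Submodule.span ℝ (Set.range ⇑(fundamentalRep (Fin 2))) := fun y e =>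
    quat_mem_span _ _ _ _
  set bq : (Edge 3 L × Fin 4 → ℝ) → Edge 3 L × Fin 4 → ℝ := fun y p =>
    ![(S.drift (Φ y) p.1 0 0).re, (S.drift (Φ y) p.1 0 0).im, (S.drift (Φ y) p.1 0 1).re,
      (S.drift (Φ y) p.1 0 1).im] p.2 with hbq
  set sq : (Edge 3 L × Fin 4 → ℝ) → Edge 3 L × Fin 4 → NoiseIdx 2 → ℝ := fun y p n =>
    ![(S.noise (Φ y) p.1 n 0 0).re, (S.noise (Φ y) p.1 n 0 0).im, (S.noise (Φ y) p.1 n 0 1).re,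
      (S.noise (Φ y) p.1 n 0 1).im] p.2 with hsq
  set c : Edge 3 L × Fin 4 → NoiseIdx 2 → Fin (Fintype.card (Edge 3 L × NoiseIdx 2)) := fun p n =>
    Fintype.equivFin (Edge 3 L × NoiseIdx 2) (p.1, n) with hc
  set x₀ : Edge 3 L × Fin 4 → ℝ := fun p =>
    ![(Q₀ p.1 0 0).re, (Q₀ p.1 0 0).im, (Q₀ p.1 0 1).re, (Q₀ p.1 0 1).im] p.2 with hx₀
  set K' : ℝ := 2 * Kp * (Fintype.card (Edge 3 L)) * (Fintype.card (NoiseIdx 2)) with hK'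
  have hK'0 : 0 ≤ K' := by positivity
  have hN1 : (1 : ℝ) ≤ Fintype.card (NoiseIdx 2) := by exact_mod_cast Fintype.card_pos
  -- Lipschitz bounds in coordinates
  have hb : ∀ y y' : Edge 3 L × Fin 4 → ℝ, ∑ p, (bq y p - bq y' p) ^ 2 ≤ K' * ∑ p, (y p - y' p) ^ 2 := by
    intro y y'
    have hS : 0 ≤ ∑ p, (y p - y' p) ^ 2 := Finset.sum_nonneg fun _ _ => sq_nonneg _
    have h1 : ∀ e, ∑ a : Fin 4, (bq y (e, a) - bq y' (e, a)) ^ 2 ≤ 2 * Kp * ∑ p, (y p - y' p) ^ 2 := by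
      intro e
      simp only [hbq, hΦ]
      exact quatCoord_lipschitz (F := fun Q => S.drift Q e) (fun Q Q' => hSd' Q Q' e) y y'
    rw [Fintype.sum_prod_type (fun p : Edge 3 L × Fin 4 => (bq y p - bq y' p) ^ 2)]
    calc ∑ e, ∑ a, (bq y (e, a) - bq y' (e, a)) ^ 2 ≤ ∑ _e : Edge 3 L, 2 * Kp * ∑ p, (y p - y' p) ^ 2 :=
          Finset.sum_le_sum fun e _ => h1 e
      _ = (Fintype.card (Edge 3 L) : ℝ) * (2 * Kp * ∑ p, (y p - y' p) ^ 2) := by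
          rw [Finset.sum_const, Finset.card_univ, nsmul_eq_mul]
      _ ≤ K' * ∑ p, (y p - y' p) ^ 2 := by
          rw [hK']
          have : (Fintype.card (Edge 3 L) : ℝ) * (2 * Kp * ∑ p, (y p - y' p) ^ 2) * 1 ≤
              (Fintype.card (Edge 3 L) : ℝ) * (2 * Kp * ∑ p, (y p - y' p) ^ 2) * Fintype.card (NoiseIdx 2) :=
            mul_le_mul_of_nonneg_left hN1 (by positivity)
          nlinarith
  have hσ : ∀ y y' : Edge 3 L × Fin 4 → ℝ,
      ∑ p, ∑ n, (sq y p n - sq y' p n) ^ 2 ≤ K' * ∑ p, (y p - y' p) ^ 2 := by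
    intro y y'
    have h1 : ∀ e n, ∑ a : Fin 4, (sq y (e, a) n - sq y' (e, a) n) ^ 2 ≤ 2 * Kp * ∑ p, (y p - y' p) ^ 2 := by
      intro e n
      simp only [hsq, hΦ]
      exact quatCoord_lipschitz (F := fun Q => S.noise Q e n) (fun Q Q' => hSn' Q Q' e n) y y'
    rw [Fintype.sum_prod_type (fun p : Edge 3 L × Fin 4 => ∑ n, (sq y p n - sq y' p n) ^ 2)]
    calc ∑ e, ∑ a, ∑ n, (sq y (e, a) n - sq y' (e, a) n) ^ 2
        = ∑ e, ∑ n, ∑ a, (sq y (e, a) n - sq y' (e, a) n) ^ 2 :=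
          Finset.sum_congr rfl fun e _ => Finset.sum_comm
      _ ≤ ∑ _e : Edge 3 L, ∑ _n : NoiseIdx 2, 2 * Kp * ∑ p, (y p - y' p) ^ 2 :=
          Finset.sum_le_sum fun e _ => Finset.sum_le_sum fun n _ => h1 e n
      _ = K' * ∑ p, (y p - y' p) ^ 2 := by
          rw [Finset.sum_const, Finset.sum_const, Finset.card_univ, Finset.card_univ, nsmul_eq_mul,
            nsmul_eq_mul, hK']
          ring
  -- the Picard solution in coordinates
  obtain ⟨Y, JY, hYp, hYc, hY2, hY0, hJY, hYeq⟩ :=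
    exists_vecSDE_solution (ι := Edge 3 L × Fin 4) (κ := NoiseIdx 2) hW bq sq c hK'0 hb hσ x₀
  rw [← hfil] at hYp hJY
  -- pathwise continuity of the matrix process
  have hXc : ∀ ω, (∀ p, Continuous fun t => Y p t ω) → Continuous fun t => Φ (fun p => Y p t ω) := by
    intro ω hω
    simp only [hΦ]
    exact continuous_quatConfig (y := fun p t => Y p t ω) hω
  -- coefficient facts along the process
  have hSdc : ∀ e, Continuous fun Q : MatrixConfig 3 L 2 => S.drift Q e := fun e =>
    continuous_of_hsForm_lipschitz fun Q Q' => hSd Q Q' e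
  have hNV : ∀ y e n, S.noise (Φ y) e n ∈ Submodule.span ℝ (Set.range ⇑(fundamentalRep (Fin 2))) :=
    fun y e n => ((hSV _ (hΦV y)) e).2 n
  have hDV : ∀ y e, S.drift (Φ y) e ∈ Submodule.span ℝ (Set.range ⇑(fundamentalRep (Fin 2))) :=
    fun y e => ((hSV _ (hΦV y)) e).1
  refine ⟨fun t ω => Φ (fun p => Y p t ω), ⟨?_, ?_, ?_, ?_, ?_, ?_⟩, fun t ω e => hΦV (fun p => Y p t ω) e⟩
  · -- adapted
    intro t
    have hm : ∀ p, Measurable[hW.natFiltration t] (Y p t) := fun p =>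
      ((hYp p).stronglyAdapted t).measurable
    simp only [hΦ]
    exact measurable_quatConfig (f := fun p ω => Y p t ω) hm
  · -- entrywise progressive
    intro e i j
    simp only [hΦ]
    exact isStronglyProgressive_quatConfig hYp e i j
  · -- a.s. continuous paths
    filter_upwards [hYc] with ω hω
    exact hXc ω hω
  · -- L²(sup)
    intro t
    have hle : ∀ ω, (⨆ s ∈ Set.Iic t, ENNReal.ofReal (∑ e, hsForm 2 (Φ (fun p => Y p s ω) e) (Φ (fun p => Y p s ω) e))) ≤
        2 * ⨆ s ∈ Set.Iic t, ENNReal.ofReal (∑ p, Y p s ω ^ 2) := by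
      intro ω
      refine iSup₂_le fun s hs => ?_
      have heq : ∑ e, hsForm 2 (Φ (fun p => Y p s ω) e) (Φ (fun p => Y p s ω) e) = 2 * ∑ p, Y p s ω ^ 2 := by
        simp only [hΦ]
        exact hsForm_quatConfig_sum (fun p => Y p s ω)
      rw [heq, ENNReal.ofReal_mul zero_le_two, ENNReal.ofReal_ofNat]
      exact mul_le_mul' le_rfl (le_iSup₂_of_le s hs le_rfl)
    refine (lintegral_mono hle).trans_lt ?_
    rw [lintegral_const_mul' _ _ (by norm_num)]
    exact ENNReal.mul_lt_top (by norm_num) (hY2 t)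
  · -- initial condition
    intro ω
    funext e
    have h0 : Y (e, 0) 0 ω = (Q₀ e 0 0).re := by rw [hY0]; simp [hx₀]
    have h1 : Y (e, 1) 0 ω = (Q₀ e 0 0).im := by rw [hY0]; simp [hx₀]
    have h2 : Y (e, 2) 0 ω = (Q₀ e 0 1).re := by rw [hY0]; simp [hx₀]
    have h3 : Y (e, 3) 0 ω = (Q₀ e 0 1).im := by rw [hY0]; simp [hx₀]
    simp only [hΦ, h0, h1, h2, h3]
    exact quat_eq_of_mem_span (hQ₀ e)
  · -- the Itô integrals and the integral equations
    refine ⟨fun e n i j t ω => (!![((JY (e, 0) n t ω : ℝ) : ℂ) + ((JY (e, 1) n t ω : ℝ) : ℂ) * Complex.I,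
        ((JY (e, 2) n t ω : ℝ) : ℂ) + ((JY (e, 3) n t ω : ℝ) : ℂ) * Complex.I;
        -((JY (e, 2) n t ω : ℝ) : ℂ) + ((JY (e, 3) n t ω : ℝ) : ℂ) * Complex.I,
        ((JY (e, 0) n t ω : ℝ) : ℂ) - ((JY (e, 1) n t ω : ℝ) : ℂ) * Complex.I] : Matrix (Fin 2) (Fin 2) ℂ) i j,
      fun e n i j => ?_, ?_⟩
    · -- IsItoIntegralC, entry by entry
      have hI0 : IsItoIntegral (fun t ω => (S.noise (Φ (fun p => Y p t ω)) e n 0 0).re)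
          (fun t ω => W t ω (e, n)) (JY (e, 0) n) hW.natFiltration P := by
        simpa [hsq, hc] using (hJY (e, 0) n).1
      have hI1 : IsItoIntegral (fun t ω => (S.noise (Φ (fun p => Y p t ω)) e n 0 0).im)
          (fun t ω => W t ω (e, n)) (JY (e, 1) n) hW.natFiltration P := by
        simpa [hsq, hc] using (hJY (e, 1) n).1
      have hI2 : IsItoIntegral (fun t ω => (S.noise (Φ (fun p => Y p t ω)) e n 0 1).re)
          (fun t ω => W t ω (e, n)) (JY (e, 2) n) hW.natFiltration P := by
        simpa [hsq, hc] using (hJY (e, 2) n).1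
      have hI3 : IsItoIntegral (fun t ω => (S.noise (Φ (fun p => Y p t ω)) e n 0 1).im)
          (fun t ω => W t ω (e, n)) (JY (e, 3) n) hW.natFiltration P := by
        simpa [hsq, hc] using (hJY (e, 3) n).1
      have h10r : (fun t ω => (S.noise (Φ (fun p => Y p t ω)) e n 1 0).re) =
          fun t ω => -(S.noise (Φ (fun p => Y p t ω)) e n 0 1).re :=
        funext fun t => funext fun ω => (re_im_of_mem_span (hNV (fun p => Y p t ω) e n)).1
      have h10i : (fun t ω => (S.noise (Φ (fun p => Y p t ω)) e n 1 0).im) =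
          fun t ω => (S.noise (Φ (fun p => Y p t ω)) e n 0 1).im :=
        funext fun t => funext fun ω => (re_im_of_mem_span (hNV (fun p => Y p t ω) e n)).2.1
      have h11r : (fun t ω => (S.noise (Φ (fun p => Y p t ω)) e n 1 1).re) =
          fun t ω => (S.noise (Φ (fun p => Y p t ω)) e n 0 0).re :=
        funext fun t => funext fun ω => (re_im_of_mem_span (hNV (fun p => Y p t ω) e n)).2.2.1
      have h11i : (fun t ω => (S.noise (Φ (fun p => Y p t ω)) e n 1 1).im) =
          fun t ω => -(S.noise (Φ (fun p => Y p t ω)) e n 0 0).im :=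
        funext fun t => funext fun ω => (re_im_of_mem_span (hNV (fun p => Y p t ω) e n)).2.2.2
      fin_cases i <;> fin_cases j <;>
        simp only [IsItoIntegralC, Fin.zero_eta, Fin.mk_one, Fin.isValue, Matrix.of_apply, Matrix.cons_val',
          Matrix.cons_val_zero, Matrix.cons_val_one, Matrix.cons_val_fin_one, Complex.add_re, Complex.add_im,
          Complex.sub_re, Complex.sub_im, Complex.neg_re, Complex.neg_im, Complex.ofReal_re, Complex.ofReal_im,
          Complex.mul_re, Complex.mul_im, Complex.I_re, Complex.I_im, mul_zero, mul_one, sub_zero, zero_sub,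
          zero_add, add_zero, neg_zero]
      · exact ⟨hI0, hI1⟩
      · exact ⟨hI2, hI3⟩
      · rw [h10r, h10i]
        exact ⟨IsItoIntegral.neg hI2, hI3⟩
      · rw [h11r, h11i]
        exact ⟨hI0, IsItoIntegral.neg hI1⟩
    · -- the integral equations
      filter_upwards [hYeq, hYc] with ω hωeq hωc t e i j
      -- interval integrability of the drift entries along the (continuous) path
      have hpath : Continuous fun s : ℝ => S.drift (Φ (fun p => Y p s.toNNReal ω)) e :=
        (hSdc e).comp ((hXc ω hωc).comp continuous_real_toNNReal)
      have hint : ∀ i' j' : Fin 2, IntervalIntegrable (fun s : ℝ => S.drift (Φ (fun p => Y p s.toNNReal ω)) e i' j')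
          volume 0 t := fun i' j' =>
        (((continuous_apply j').comp (continuous_apply i')).comp hpath).intervalIntegrable _ _
      have hre : ∀ i' j' : Fin 2, (∫ s in (0 : ℝ)..t, S.drift (Φ (fun p => Y p s.toNNReal ω)) e i' j').re =
          ∫ s in (0 : ℝ)..t, (S.drift (Φ (fun p => Y p s.toNNReal ω)) e i' j').re := fun i' j' => by
        have h := intervalIntegral.intervalIntegral_re (hint i' j')
        simpa using h.symm
      have him : ∀ i' j' : Fin 2, (∫ s in (0 : ℝ)..t, S.drift (Φ (fun p => Y p s.toNNReal ω)) e i' j').im =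
          ∫ s in (0 : ℝ)..t, (S.drift (Φ (fun p => Y p s.toNNReal ω)) e i' j').im := fun i' j' => by
        have h := intervalIntegral.intervalIntegral_im (hint i' j')
        simpa using h.symm
      -- the four coordinate equations
      have hA0 : Y (e, 0) t ω = (Q₀ e 0 0).re +
          (∫ s in (0 : ℝ)..t, (S.drift (Φ (fun p => Y p s.toNNReal ω)) e 0 0).re) + ∑ n, JY (e, 0) n t ω := by
        simpa [hbq, hx₀] using hωeq t (e, 0)
      have hA1 : Y (e, 1) t ω = (Q₀ e 0 0).im +
          (∫ s in (0 : ℝ)..t, (S.drift (Φ (fun p => Y p s.toNNReal ω)) e 0 0).im) + ∑ n, JY (e, 1) n t ω := by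
        simpa [hbq, hx₀] using hωeq t (e, 1)
      have hA2 : Y (e, 2) t ω = (Q₀ e 0 1).re +
          (∫ s in (0 : ℝ)..t, (S.drift (Φ (fun p => Y p s.toNNReal ω)) e 0 1).re) + ∑ n, JY (e, 2) n t ω := by
        simpa [hbq, hx₀] using hωeq t (e, 2)
      have hA3 : Y (e, 3) t ω = (Q₀ e 0 1).im +
          (∫ s in (0 : ℝ)..t, (S.drift (Φ (fun p => Y p s.toNNReal ω)) e 0 1).im) + ∑ n, JY (e, 3) n t ω := by
        simpa [hbq, hx₀] using hωeq t (e, 3)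
      -- V-relations for `Q₀` and for the drift along the path
      obtain ⟨hq10r, hq10i, hq11r, hq11i⟩ := re_im_of_mem_span (hQ₀ e)
      have hd10r : ∀ s : ℝ, (S.drift (Φ (fun p => Y p s.toNNReal ω)) e 1 0).re =
          -(S.drift (Φ (fun p => Y p s.toNNReal ω)) e 0 1).re := fun s => (re_im_of_mem_span (hDV (fun p => Y p s.toNNReal ω) e)).1
      have hd10i : ∀ s : ℝ, (S.drift (Φ (fun p => Y p s.toNNReal ω)) e 1 0).im =
          (S.drift (Φ (fun p => Y p s.toNNReal ω)) e 0 1).im := fun s => (re_im_of_mem_span (hDV (fun p => Y p s.toNNReal ω) e)).2.1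
      have hd11r : ∀ s : ℝ, (S.drift (Φ (fun p => Y p s.toNNReal ω)) e 1 1).re =
          (S.drift (Φ (fun p => Y p s.toNNReal ω)) e 0 0).re := fun s => (re_im_of_mem_span (hDV (fun p => Y p s.toNNReal ω) e)).2.2.1
      have hd11i : ∀ s : ℝ, (S.drift (Φ (fun p => Y p s.toNNReal ω)) e 1 1).im =
          -(S.drift (Φ (fun p => Y p s.toNNReal ω)) e 0 0).im := fun s => (re_im_of_mem_span (hDV (fun p => Y p s.toNNReal ω) e)).2.2.2
      -- entries of the chart and of the integrals
      obtain ⟨h00r, h00i, h01r, h01i, h10r', h10i', h11r', h11i'⟩ :=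
        quat_entries (Y (e, 0) t ω) (Y (e, 1) t ω) (Y (e, 2) t ω) (Y (e, 3) t ω)
      have hX00r : (Φ (fun p => Y p t ω) e 0 0).re = Y (e, 0) t ω := h00r
      have hX00i : (Φ (fun p => Y p t ω) e 0 0).im = Y (e, 1) t ω := h00i
      have hX01r : (Φ (fun p => Y p t ω) e 0 1).re = Y (e, 2) t ω := h01r
      have hX01i : (Φ (fun p => Y p t ω) e 0 1).im = Y (e, 3) t ω := h01i
      have hX10r : (Φ (fun p => Y p t ω) e 1 0).re = -Y (e, 2) t ω := h10r'
      have hX10i : (Φ (fun p => Y p t ω) e 1 0).im = Y (e, 3) t ω := h10i'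
      have hX11r : (Φ (fun p => Y p t ω) e 1 1).re = Y (e, 0) t ω := h11r'
      have hX11i : (Φ (fun p => Y p t ω) e 1 1).im = -Y (e, 1) t ω := h11i'
      have hI10r : ∫ s in (0 : ℝ)..t, (S.drift (Φ (fun p => Y p s.toNNReal ω)) e 1 0).re =
          -∫ s in (0 : ℝ)..t, (S.drift (Φ (fun p => Y p s.toNNReal ω)) e 0 1).re := by
        rw [← intervalIntegral.integral_neg]
        exact intervalIntegral.integral_congr fun s _ => hd10r s
      have hI10i : ∫ s in (0 : ℝ)..t, (S.drift (Φ (fun p => Y p s.toNNReal ω)) e 1 0).im =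
          ∫ s in (0 : ℝ)..t, (S.drift (Φ (fun p => Y p s.toNNReal ω)) e 0 1).im :=
        intervalIntegral.integral_congr fun s _ => hd10i s
      have hI11r : ∫ s in (0 : ℝ)..t, (S.drift (Φ (fun p => Y p s.toNNReal ω)) e 1 1).re =
          ∫ s in (0 : ℝ)..t, (S.drift (Φ (fun p => Y p s.toNNReal ω)) e 0 0).re :=
        intervalIntegral.integral_congr fun s _ => hd11r s
      have hI11i : ∫ s in (0 : ℝ)..t, (S.drift (Φ (fun p => Y p s.toNNReal ω)) e 1 1).im =
          -∫ s in (0 : ℝ)..t, (S.drift (Φ (fun p => Y p s.toNNReal ω)) e 0 0).im := by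
        rw [← intervalIntegral.integral_neg]
        exact intervalIntegral.integral_congr fun s _ => hd11i s
      apply Complex.ext <;> fin_cases i <;> fin_cases j <;>
        simp only [Fin.zero_eta, Fin.mk_one, Fin.isValue, Complex.add_re, Complex.add_im, Complex.re_sum,
          Complex.im_sum, Matrix.of_apply, Matrix.cons_val', Matrix.cons_val_zero, Matrix.cons_val_one,
          Matrix.cons_val_fin_one, Complex.sub_re, Complex.sub_im, Complex.neg_re, Complex.neg_im,
          Complex.ofReal_re, Complex.ofReal_im, Complex.mul_re, Complex.mul_im, Complex.I_re, Complex.I_im,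
          mul_zero, mul_one, sub_zero, zero_sub, zero_add, add_zero, neg_zero, Finset.sum_neg_distrib]
      · rw [hX00r, hre 0 0]; linarith
      · rw [hX01r, hre 0 1]; linarith
      · rw [hX10r, hre 1 0, hI10r, hq10r]; linarith
      · rw [hX11r, hre 1 1, hI11r, hq11r]; linarith
      · rw [hX00i, him 0 0]; linarith
      · rw [hX01i, him 0 1]; linarith
      · rw [hX10i, him 1 0, hI10i, hq10i]; linarith
      · rw [hX11i, him 1 1, hI11i, hq11i]; linarith

end Summit.QuantumFields.YangMills.Theorems.ColdStartUniversality

end
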